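import Summits.QuantumFields.YangMills.Theorems.BalabanUVNodesN21GappedRoadK3V6Knit
import Summits.QuantumFields.YangMills.Theorems.BalabanUVNodesN21GappedTopPairReading13CoPHSignAware

/-!
# N21 (NE7c) · THE K3⁸ KNIT ON THE PAIR ROAD, BY NAME — V1's reading-generic live pin (`…N21GappedRoadK3V6Knit` §1, p629674) instantiated at dag-n21-w7's DOUBLY-GAPPED
# reading `crGap2₁₃V 2 (jc …) ρ ρ′ n₁ n₂`: a spine reading pinned to it on the live line and to `crOneTerm₁₃ 0` off it has N21's `KeyedShellWeight` AND N27x's `KeyedExtractionV`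
# as THEOREMS (both indicator families of the last 𝐓-step, both sides of both cuts); K3⁸ follows from K4 + N20 + N19′ at the doubly-gapped objects

R134 seat `pub-ymgap-dag-n21-d` (g12, lane owner N21), strategy s2; key K3⁸ `SpineGivenEndpointR13SepCoPHV` = stmt-QuantumFields-27366, `--kind proof --supports 27366 --as helper`;
COUNT-NEUTRAL.  Theorems only (0 `def`).  Imports V1 (the generic live-pin lemmas `keyedShellWeight_of_livePin` ∕ `keyedRelWeight_of_livePin` ∕ `keyedExtractionBFree_of_livePin` ∕
`keyedCoreEdgeHolderD4V_of_livePin` ∕ `exists_reading_livePin` ∕ `spineGivenEndpointR13SepCoPHV_of_livePin`, and through it `K3V6Defs`, `K3V5Defs`, dag-n20-w1's one-term reading)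
and V6 `…N21GappedTopPairReading13CoPHSignAware` (`shellWeightBound_carriersGap2₁₃'` ∕ `shellWeightBound_crGap2₁₃VAt'`: dag-n21-w7's pair faces re-keyed on the SATISFIABLE
rows «sign OR width zero» — their own ∀-sign rows being refutable as ∀-rows over `g₀`), and through it dag-n21-w7 g2's `…N21GappedTopPairReading13CoPHFaces`
(`sum_classSet₁₃_gapWeight2A∕B₁₃_eq_schemeZ` ∕ `relWeightBound_crGap2₁₃VAt` ∕ `core_crGap2₁₃VAt`; `crGap2₁₃V(At)`, `gapWeight2∕gapShell2∕gapCore2 A∕B₁₃`,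
`gapWeight2A∕B₁₃_sub_gapShell2A∕B₁₃`) — all BY NAME; nothing of theirs re-typed.
[III] = [Balaban1988Convergent], [LF-I] = [Balaban1989LargeFieldI].

WHAT IS PROVED (kernel; [bookkeeping]; NO estimate).  At `crL := crGap2₁₃V 2 (jc …) ρ ρ′ n₁ n₂`: ★★★ `keyedShellWeight_of_gap2Pin` (N21's v6 face = THEOREM on the pinned reading;
rows: (H-ζ) on the live line, `0 ≤ ρ, ρ′ ≤ 1`, `Σ (1∕(n₁ K+1) + 1∕(n₂ K+1)) < ∞`, and the SATISFIABLE rows «`0 ≤ ε` at both tops OR `ρ_K = 0`», «`0 ≤ δ` at both old levels OR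
`ρ′_K = 0`» (sign-aware dials satisfy them for every `(θ, g₀)`)) · ★★
`keyedExtraction_of_gap2Pin` (N27x's (B)-free AND slot-keyed faces, row (H-ζ)) · `keyedRelWeight_of_gap2Pin_of_witness` · `keyedCoreEdgeHolderD4V_of_gap2Pin_of_witness` · ★★★
`spineGivenEndpointR13SepCoPHV_of_gap2Pin` · ★★★ `spineGivenEndpointR13SepCoPHV_of_gap2Road` (pin-free) · ★★ `exists_gap2Pinned_faces`.

HONEST FRAMING (binding).  Bookkeeping BY NAME; NO estimate of Bałaban's; NE7c at print's FIXED thresholds NOT PRINTED ∕ NOT proved; (M1)-free at SELECTED relative letters for BOTH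
indicator families of the last 𝐓-step (the (3.5)∕ζ residual weights and the recent levels below the top stay LOCATED); K4 ∕ N20 ∕ N19′ ∕ node U5's Target are HYPOTHESES (K0⁷ OPEN);
NOT `stub_expansion13HV` (its `PinnedAtLive` names `crOfRecord₁₃V`); N21 NOT discharged; K3⁸ NOT claimed; counts UNMOVED (typed 28∕28 · discharged 5∕27); never a count claim.
No `sorry`, no `def`, no `instance`, no `notation`; standard axioms.  One finite four-torus programme at fixed `ε` — NOT ℝ⁴, NOT OS, NOT a mass gap, NOT the Clay problem.
-/

set_option autoImplicit false

noncomputable section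

open scoped BigOperators

namespace Summit.QuantumFields.YangMills.Theorems.N21GappedRoadK3V6Knit

open Literature.MathematicalPhysics.QuantumFieldTheory.Balaban1983to89
open Literature.MathematicalPhysics.QuantumFieldTheory.Balaban1983to89.T4Continuum
open Literature.MathematicalPhysics.QuantumFieldTheory.Balaban1983to89.Node00
open T4WeightBudget (RelWeightBound)
open T4IndicatorShell (ShellWeightBound)
open T4ContinuumYM4Torus (ForSmallCouplings)
open Summit.QuantumFields.BalabanUV.T4Continuum.Spine
open YMDAG.UVSplit (SpineReading₁₃CoPH classSet₁₃ badClass₁₃ histA₁₃ histB₁₃)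
open Summit.QuantumFields.YangMills.BalabanUVNodes.SpineCanonicalWeights (core_nonneg_of_shellWeightBound)
open Summit.QuantumFields.YangMills.Theorems.K3V5Defs (SpineReading RateReadingFn CutReading KeyedRelWeight KeyedShellWeight LiveSel PHolderD4)
open Summit.QuantumFields.YangMills.Theorems.K3V6Defs (KeyedRatesHolderD4V KeyedCoreEdgeHolderD4V KeyedExtractionV KeyedExtractionBFree keyedExtractionV_of_bFree
  spineGivenEndpointR13SepCoPHV_of_facesV)
open Summit.QuantumFields.YangMills.BalabanUVNodes.N20OffLiveOneTermReading (crOneTerm₁₃)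
open Summit.QuantumFields.YangMills.Theorems.N21ShellSplitOfRecord13CoPH (WidthLetter₁₃CoPH DepthLetter₁₃CoPH shellWeightBound_carriersGap2₁₃' shellWeightBound_crGap2₁₃VAt')
open Summit.QuantumFields.YangMills.Theorems.N21GappedTopPair13CoPH (crGap2₁₃V crGap2₁₃VAt gapWeight2A₁₃ gapWeight2B₁₃ gapShell2A₁₃ gapShell2B₁₃ gapCore2A₁₃ gapCore2B₁₃
  sum_classSet₁₃_gapWeight2A₁₃_eq_schemeZ sum_classSet₁₃_gapWeight2B₁₃_eq_schemeZ relWeightBound_crGap2₁₃VAt core_crGap2₁₃VAt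
  gapWeight2A₁₃_sub_gapShell2A₁₃ gapWeight2B₁₃_sub_gapShell2B₁₃)

/-! ## §4 The pair road: `crL := crGap2₁₃V 2 (jc …) ρ ρ′ n₁ n₂` -/

section Gap2Pin

variable (jc : CutReading) (ρ ρ' : WidthLetter₁₃CoPH 2) (n₁ n₂ : DepthLetter₁₃CoPH 2) {cr : SpineReading}
  (hon : ∀ (F : T4Family) (θ : Stage13HParams F 2) (hP : θ.Provisos₁₃CoPH F 2) (g₀ : ℕ → ℝ) (os : List (ULoop F)),
    LiveSel F θ → cr F θ hP g₀ os = crGap2₁₃V 2 (jc F θ hP g₀ os) ρ ρ' n₁ n₂ F θ hP g₀ os)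
  (hoff : ∀ (F : T4Family) (θ : Stage13HParams F 2) (hP : θ.Provisos₁₃CoPH F 2) (g₀ : ℕ → ℝ) (os : List (ULoop F)), ¬ LiveSel F θ → cr F θ hP g₀ os = crOneTerm₁₃ 0 F θ hP g₀ os)
  (hζm : ∀ (F : T4Family) (θ : Stage13HParams F 2), θ.Provisos₁₃CoPH F 2 → ((θ.ZhUnity F 2 ∧ θ.SlotsNondegenerate₁₃ F 2) ∧ LiveSel F θ) → θ.Admissible F 2 →
    ZetaMeasurable F 2 θ.ζ)
include hon hoff hζm

/-- ★★★ **N21's v6 FACE ON THE PAIR-PINNED READING IS A THEOREM** — `KeyedShellWeight cr` for `cr` pinned to `crGap2₁₃V 2 (jc …) ρ ρ′ n₁ n₂` on the live line and to `crOneTerm₁₃ 0`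
off it (dag-n21-w7's `shellWeightBound_crGap2₁₃VAt`: both indicator families of the last 𝐓-step, both sides of both cuts, (M1)-FREE).  Rows: (H-ζ) on the live line; the dial rows;
the satisfiable rows «`0 ≤ ε` at both tops OR `ρ_K = 0`», «`0 ≤ δ` at both old levels OR `ρ′_K = 0`» (V6). [bookkeeping] -/
theorem keyedShellWeight_of_gap2Pin
    (hρ : ∀ (F : T4Family) (θ : Stage13HParams F 2) (hP : θ.Provisos₁₃CoPH F 2) (g₀ : ℕ → ℝ) (os : List (ULoop F)) (K : ℕ),
      (0 ≤ ρ F θ hP g₀ os K ∧ ρ F θ hP g₀ os K ≤ 1) ∧ (0 ≤ ρ' F θ hP g₀ os K ∧ ρ' F θ hP g₀ os K ≤ 1))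
    (hn : ∀ (F : T4Family) (θ : Stage13HParams F 2) (hP : θ.Provisos₁₃CoPH F 2) (g₀ : ℕ → ℝ) (os : List (ULoop F)),
      Summable (fun K => 1 / ((n₁ F θ hP g₀ os K : ℝ) + 1) + 1 / ((n₂ F θ hP g₀ os K : ℝ) + 1)))
    (hε : ∀ (F : T4Family) (θ : Stage13HParams F 2) (hP : θ.Provisos₁₃CoPH F 2) (g₀ : ℕ → ℝ) (os : List (ULoop F)) (K : ℕ),
      (0 ≤ epsOfRecord θ.ν (histA₁₃ θ 0 g₀ K) (0 + K) ∧ 0 ≤ epsOfRecord θ.ν (histB₁₃ θ 0 g₀ K) (0 + K + 1)) ∨ ρ F θ hP g₀ os K = 0)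
    (hδ : ∀ (F : T4Family) (θ : Stage13HParams F 2) (hP : θ.Provisos₁₃CoPH F 2) (g₀ : ℕ → ℝ) (os : List (ULoop F)) (K : ℕ),
      (0 ≤ deltaOfRecord θ.ν (histA₁₃ θ 0 g₀ K) (0 + K - 1) θ.A₁ ∧ 0 ≤ deltaOfRecord θ.ν (histB₁₃ θ 0 g₀ K) (0 + K) θ.A₁) ∨ ρ' F θ hP g₀ os K = 0) :
    KeyedShellWeight cr :=
  keyedShellWeight_of_livePin hon hoff fun F θ hP hG hθ g₀ os =>
    shellWeightBound_crGap2₁₃VAt' 0 (jc F θ hP g₀ os) ρ ρ' n₁ n₂ θ hP g₀ os (EOfRecord₁₃ F 2 θ.toStage13Params) hG.2 (hζm F θ hP hG hθ)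
      (fun K => (hρ F θ hP g₀ os K).1.1) (fun K => (hρ F θ hP g₀ os K).1.2) (fun K => (hρ F θ hP g₀ os K).2.1) (fun K => (hρ F θ hP g₀ os K).2.2)
      (hε F θ hP g₀ os) (hδ F θ hP g₀ os) (hn F θ hP g₀ os)

/-- ★★ **N27x's FACES ON THE PAIR-PINNED READING ARE THEOREMS** — the (B)-free face `KeyedExtractionBFree cr` (dag-n21-w7's E1∕E2 `sum_classSet₁₃_gapWeight2A∕B₁₃_eq_schemeZ`;
row (H-ζ)) AND the slot-keyed v6 face `KeyedExtractionV cr` (V1's `keyedExtractionV_of_bFree`), stated together. [bookkeeping] -/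
theorem keyedExtraction_of_gap2Pin : KeyedExtractionBFree cr ∧ KeyedExtractionV cr := by
  have hB : KeyedExtractionBFree cr :=
    keyedExtractionBFree_of_livePin hon hoff fun F θ hP hG hθ =>
      ForSmallCouplings.of_forall fun g₀ os =>
        ⟨one_pos, pow_pos F.side_pos 4,
          fun K t _ => (sum_classSet₁₃_gapWeight2A₁₃_eq_schemeZ 0 θ hP g₀ os (EOfRecord₁₃ F 2 θ.toStage13Params) hG.2 (hζm F θ hP hG hθ) _ _ _ _ K t).symm,
          fun K t _ => (sum_classSet₁₃_gapWeight2B₁₃_eq_schemeZ 0 θ hP g₀ os (EOfRecord₁₃ F 2 θ.toStage13Params) hG.2 (hζm F θ hP hG hθ) _ _ _ _ K t).symm⟩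
  exact ⟨hB, keyedExtractionV_of_bFree hB⟩

omit hζm in
/-- **N20's face on the pair-pinned reading FROM A WITNESS at the doubly-gapped carriers** on the live line (dag-n21-w7's transfer `relWeightBound_crGap2₁₃VAt`); outright off the
line.  A HYPOTHESIS (by V5b the same statement as at n20-d's reading of record). [bookkeeping] -/
theorem keyedRelWeight_of_gap2Pin_of_witness
    (h20 : ∀ (F : T4Family) (θ : Stage13HParams F 2) (hP : θ.Provisos₁₃CoPH F 2), ((θ.ZhUnity F 2 ∧ θ.SlotsNondegenerate₁₃ F 2) ∧ LiveSel F θ) → θ.Admissible F 2 →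
      ∀ (g₀ : ℕ → ℝ) (os : List (ULoop F)),
        ∃ W : ℕ → ℝ, RelWeightBound 1 (classSet₁₃ θ 0 g₀)
          (gapWeight2A₁₃ θ hP 0 g₀ os (ρ F θ hP g₀ os) (ρ' F θ hP g₀ os) (n₁ F θ hP g₀ os) (n₂ F θ hP g₀ os))
          (gapWeight2B₁₃ θ hP 0 g₀ os (ρ F θ hP g₀ os) (ρ' F θ hP g₀ os) (n₁ F θ hP g₀ os) (n₂ F θ hP g₀ os)) (badClass₁₃ θ 0 g₀ (jc F θ hP g₀ os)) W) :
    KeyedRelWeight cr :=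
  keyedRelWeight_of_livePin hon hoff fun F θ hP hG hθ g₀ os => by
    obtain ⟨W, hW⟩ := h20 F θ hP hG hθ g₀ os
    exact relWeightBound_crGap2₁₃VAt 0 (jc F θ hP g₀ os) ρ ρ' n₁ n₂ θ hP g₀ os hW

/-- **N19′'s slot-keyed face on the pair-pinned reading FROM A WITNESS at the doubly-gapped cores** `gapCore2A∕B₁₃` on the live line (v6 shape) AND node U5's Target off the line; core
non-negativity from the PROVED N21 face.  Both HYPOTHESES; NE7 NOT PRINTED for `d = 4`. [bookkeeping] -/
theorem keyedCoreEdgeHolderD4V_of_gap2Pin_of_witness (β : ℝ) (rr : RateReadingFn)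
    (hρ : ∀ (F : T4Family) (θ : Stage13HParams F 2) (hP : θ.Provisos₁₃CoPH F 2) (g₀ : ℕ → ℝ) (os : List (ULoop F)) (K : ℕ),
      (0 ≤ ρ F θ hP g₀ os K ∧ ρ F θ hP g₀ os K ≤ 1) ∧ (0 ≤ ρ' F θ hP g₀ os K ∧ ρ' F θ hP g₀ os K ≤ 1))
    (hn : ∀ (F : T4Family) (θ : Stage13HParams F 2) (hP : θ.Provisos₁₃CoPH F 2) (g₀ : ℕ → ℝ) (os : List (ULoop F)),
      Summable (fun K => 1 / ((n₁ F θ hP g₀ os K : ℝ) + 1) + 1 / ((n₂ F θ hP g₀ os K : ℝ) + 1)))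
    (hε : ∀ (F : T4Family) (θ : Stage13HParams F 2) (hP : θ.Provisos₁₃CoPH F 2) (g₀ : ℕ → ℝ) (os : List (ULoop F)) (K : ℕ),
      (0 ≤ epsOfRecord θ.ν (histA₁₃ θ 0 g₀ K) (0 + K) ∧ 0 ≤ epsOfRecord θ.ν (histB₁₃ θ 0 g₀ K) (0 + K + 1)) ∨ ρ F θ hP g₀ os K = 0)
    (hδ : ∀ (F : T4Family) (θ : Stage13HParams F 2) (hP : θ.Provisos₁₃CoPH F 2) (g₀ : ℕ → ℝ) (os : List (ULoop F)) (K : ℕ),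
      (0 ≤ deltaOfRecord θ.ν (histA₁₃ θ 0 g₀ K) (0 + K - 1) θ.A₁ ∧ 0 ≤ deltaOfRecord θ.ν (histB₁₃ θ 0 g₀ K) (0 + K) θ.A₁) ∨ ρ' F θ hP g₀ os K = 0)
    (h19on : ∀ (F : T4Family) (θ : Stage13HParams F 2) (h : θ.Provisos₁₃SepCoPH F 2) (v : Revision₁₃ F 2 θ h),
      ((θ.ZhUnity F 2 ∧ θ.SlotsNondegenerate₁₃ F 2) ∧ LiveSel F θ) → θ.Admissible F 2 →
      B16.EndStatementBPrinted (datumOfRecord₁₃SepCoPHV F 2 θ h v).C → DagBinding.EndpointExistence (datumOfRecord₁₃SepCoPHV F 2 θ h v).C.toB12 →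
        ForSmallCouplings (datumOfRecord₁₃SepCoPHV F 2 θ h v) fun g₀ => ∀ os : List (ULoop F),
          PHolderD4 β (datumOfRecord₁₃SepCoPHV F 2 θ h v) (rr F θ h.toCore g₀ os) →
            letI : DecidableEq (Σ K, SiteSeqKey F (0 + K)) := Classical.decEq _
            ∃ δ : ℕ → ℝ, NE7.Core 1 (F.side ^ 4) (classSet₁₃ θ 0 g₀) (badClass₁₃ θ 0 g₀ (jc F θ h.toCore g₀ os))
              (gapCore2A₁₃ θ h.toCore 0 g₀ os (ρ F θ h.toCore g₀ os) (ρ' F θ h.toCore g₀ os) (n₁ F θ h.toCore g₀ os) (n₂ F θ h.toCore g₀ os))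
              (gapCore2B₁₃ θ h.toCore 0 g₀ os (ρ F θ h.toCore g₀ os) (ρ' F θ h.toCore g₀ os) (n₁ F θ h.toCore g₀ os) (n₂ F θ h.toCore g₀ os)) δ ∧ Summable δ)
    (h19off : ∀ (F : T4Family) (θ : Stage13HParams F 2) (hP : θ.Provisos₁₃CoPH F 2), ((θ.ZhUnity F 2 ∧ θ.SlotsNondegenerate₁₃ F 2) ∧ ¬ LiveSel F θ) → θ.Admissible F 2 →
      ∀ (g₀ : ℕ → ℝ) (os : List (ULoop F)), PHolderD4 β (datumOfRecord₁₃CoPH F 2 θ hP) (rr F θ hP g₀ os) →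
        ∃ δ : ℕ → ℝ, NE7.Target ((F.side : ℝ) ^ 4) 1 δ (fun K => T4GenFunBounds.schemeZ ((datumOfRecord₁₃CoPH F 2 θ hP).scheme g₀) os (0 + K))) :
    KeyedCoreEdgeHolderD4V β cr rr := by
  refine keyedCoreEdgeHolderD4V_of_livePin hon hoff β rr (fun F θ h v hG hθ hB hE => ?_) h19off
  refine ForSmallCouplings.mono (fun g₀ h' os hPr => ?_) (h19on F θ h v hG hθ hB hE)
  obtain ⟨δ, hδ', hsum⟩ := h' os hPr
  have hA : (fun K t x => gapWeight2A₁₃ θ h.toCore 0 g₀ os (ρ F θ h.toCore g₀ os) (ρ' F θ h.toCore g₀ os) (n₁ F θ h.toCore g₀ os) (n₂ F θ h.toCore g₀ os) K t x -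
      gapShell2A₁₃ θ h.toCore 0 g₀ os (ρ F θ h.toCore g₀ os) (ρ' F θ h.toCore g₀ os) (n₁ F θ h.toCore g₀ os) (n₂ F θ h.toCore g₀ os) K t x) =
      gapCore2A₁₃ θ h.toCore 0 g₀ os (ρ F θ h.toCore g₀ os) (ρ' F θ h.toCore g₀ os) (n₁ F θ h.toCore g₀ os) (n₂ F θ h.toCore g₀ os) :=
    funext fun K => funext fun t => funext fun x => gapWeight2A₁₃_sub_gapShell2A₁₃ θ h.toCore 0 g₀ os _ _ _ _ K t x
  have hB' : (fun K t x => gapWeight2B₁₃ θ h.toCore 0 g₀ os (ρ F θ h.toCore g₀ os) (ρ' F θ h.toCore g₀ os) (n₁ F θ h.toCore g₀ os) (n₂ F θ h.toCore g₀ os) K t x -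
      gapShell2B₁₃ θ h.toCore 0 g₀ os (ρ F θ h.toCore g₀ os) (ρ' F θ h.toCore g₀ os) (n₁ F θ h.toCore g₀ os) (n₂ F θ h.toCore g₀ os) K t x) =
      gapCore2B₁₃ θ h.toCore 0 g₀ os (ρ F θ h.toCore g₀ os) (ρ' F θ h.toCore g₀ os) (n₁ F θ h.toCore g₀ os) (n₂ F θ h.toCore g₀ os) :=
    funext fun K => funext fun t => funext fun x => gapWeight2B₁₃_sub_gapShell2B₁₃ θ h.toCore 0 g₀ os _ _ _ _ K t x
  have hsh := shellWeightBound_carriersGap2₁₃' 0 θ h.toCore g₀ os (EOfRecord₁₃ F 2 θ.toStage13Params) hG.2 (hζm F θ h.toCore hG hθ)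
    (fun K => (hρ F θ h.toCore g₀ os K).1.1) (fun K => (hρ F θ h.toCore g₀ os K).1.2) (fun K => (hρ F θ h.toCore g₀ os K).2.1) (fun K => (hρ F θ h.toCore g₀ os K).2.2)
    (hε F θ h.toCore g₀ os) (hδ F θ h.toCore g₀ os) (hn F θ h.toCore g₀ os)
  letI : DecidableEq (Σ K, SiteSeqKey F (0 + K)) := Classical.decEq _
  have hP0 := core_nonneg_of_shellWeightBound (Bad := badClass₁₃ θ 0 g₀ (jc F θ h.toCore g₀ os)) hsh
  exact ⟨_, core_crGap2₁₃VAt 0 (jc F θ h.toCore g₀ os) ρ ρ' n₁ n₂ θ h.toCore g₀ os hP0 (by rw [hA, hB']; exact hδ') hsum⟩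

/-- ★★★ **K3⁸ ON THE PAIR ROAD, AT THE PINNED READING — N21 AND N27x DISCHARGED BY NAME** (K4, N20, N19′ HYPOTHESES at the pinned reading). [bookkeeping] -/
theorem spineGivenEndpointR13SepCoPHV_of_gap2Pin (β : ℝ) (rr : RateReadingFn)
    (hρ : ∀ (F : T4Family) (θ : Stage13HParams F 2) (hP : θ.Provisos₁₃CoPH F 2) (g₀ : ℕ → ℝ) (os : List (ULoop F)) (K : ℕ),
      (0 ≤ ρ F θ hP g₀ os K ∧ ρ F θ hP g₀ os K ≤ 1) ∧ (0 ≤ ρ' F θ hP g₀ os K ∧ ρ' F θ hP g₀ os K ≤ 1))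
    (hn : ∀ (F : T4Family) (θ : Stage13HParams F 2) (hP : θ.Provisos₁₃CoPH F 2) (g₀ : ℕ → ℝ) (os : List (ULoop F)),
      Summable (fun K => 1 / ((n₁ F θ hP g₀ os K : ℝ) + 1) + 1 / ((n₂ F θ hP g₀ os K : ℝ) + 1)))
    (hε : ∀ (F : T4Family) (θ : Stage13HParams F 2) (hP : θ.Provisos₁₃CoPH F 2) (g₀ : ℕ → ℝ) (os : List (ULoop F)) (K : ℕ),
      (0 ≤ epsOfRecord θ.ν (histA₁₃ θ 0 g₀ K) (0 + K) ∧ 0 ≤ epsOfRecord θ.ν (histB₁₃ θ 0 g₀ K) (0 + K + 1)) ∨ ρ F θ hP g₀ os K = 0)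
    (hδ : ∀ (F : T4Family) (θ : Stage13HParams F 2) (hP : θ.Provisos₁₃CoPH F 2) (g₀ : ℕ → ℝ) (os : List (ULoop F)) (K : ℕ),
      (0 ≤ deltaOfRecord θ.ν (histA₁₃ θ 0 g₀ K) (0 + K - 1) θ.A₁ ∧ 0 ≤ deltaOfRecord θ.ν (histB₁₃ θ 0 g₀ K) (0 + K) θ.A₁) ∨ ρ' F θ hP g₀ os K = 0)
    (h20 : KeyedRelWeight cr) (hr : KeyedRatesHolderD4V β rr) (h19 : KeyedCoreEdgeHolderD4V β cr rr) :
    Summit.QuantumFields.YangMills.Theses.BalabanUVNodes.SpineGivenEndpointR13SepCoPHV :=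
  spineGivenEndpointR13SepCoPHV_of_facesV β cr rr h20 (keyedShellWeight_of_gap2Pin jc ρ ρ' n₁ n₂ hon hoff hζm hρ hn hε hδ) hr h19
    (keyedExtraction_of_gap2Pin jc ρ ρ' n₁ n₂ hon hoff hζm).2

end Gap2Pin

/-! ## §5 Pin-free on the pair road -/

section Gap2Road

/-- ★★★ **K3⁸ ON THE PAIR ROAD, PIN-FREE — N21 AND N27x DISCHARGED BY NAME** (displayed: (H-ζ) on the live line, the dial rows, V6's «sign OR width zero» rows, K4, N20's WITNESS at the
doubly-gapped carriers on the live line, N19′'s WITNESS at the doubly-gapped cores on the live line (slot-keyed, under the prefix and `PHolderD4 β`), node U5's Target off the line).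
[bookkeeping] -/
theorem spineGivenEndpointR13SepCoPHV_of_gap2Road (β : ℝ) (rr : RateReadingFn) (jc : CutReading) (ρ ρ' : WidthLetter₁₃CoPH 2) (n₁ n₂ : DepthLetter₁₃CoPH 2)
    (hζm : ∀ (F : T4Family) (θ : Stage13HParams F 2), θ.Provisos₁₃CoPH F 2 → ((θ.ZhUnity F 2 ∧ θ.SlotsNondegenerate₁₃ F 2) ∧ LiveSel F θ) → θ.Admissible F 2 →
      ZetaMeasurable F 2 θ.ζ)
    (hρ : ∀ (F : T4Family) (θ : Stage13HParams F 2) (hP : θ.Provisos₁₃CoPH F 2) (g₀ : ℕ → ℝ) (os : List (ULoop F)) (K : ℕ),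
      (0 ≤ ρ F θ hP g₀ os K ∧ ρ F θ hP g₀ os K ≤ 1) ∧ (0 ≤ ρ' F θ hP g₀ os K ∧ ρ' F θ hP g₀ os K ≤ 1))
    (hn : ∀ (F : T4Family) (θ : Stage13HParams F 2) (hP : θ.Provisos₁₃CoPH F 2) (g₀ : ℕ → ℝ) (os : List (ULoop F)),
      Summable (fun K => 1 / ((n₁ F θ hP g₀ os K : ℝ) + 1) + 1 / ((n₂ F θ hP g₀ os K : ℝ) + 1)))
    (hε : ∀ (F : T4Family) (θ : Stage13HParams F 2) (hP : θ.Provisos₁₃CoPH F 2) (g₀ : ℕ → ℝ) (os : List (ULoop F)) (K : ℕ),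
      (0 ≤ epsOfRecord θ.ν (histA₁₃ θ 0 g₀ K) (0 + K) ∧ 0 ≤ epsOfRecord θ.ν (histB₁₃ θ 0 g₀ K) (0 + K + 1)) ∨ ρ F θ hP g₀ os K = 0)
    (hδ : ∀ (F : T4Family) (θ : Stage13HParams F 2) (hP : θ.Provisos₁₃CoPH F 2) (g₀ : ℕ → ℝ) (os : List (ULoop F)) (K : ℕ),
      (0 ≤ deltaOfRecord θ.ν (histA₁₃ θ 0 g₀ K) (0 + K - 1) θ.A₁ ∧ 0 ≤ deltaOfRecord θ.ν (histB₁₃ θ 0 g₀ K) (0 + K) θ.A₁) ∨ ρ' F θ hP g₀ os K = 0)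
    (hr : KeyedRatesHolderD4V β rr)
    (h20 : ∀ (F : T4Family) (θ : Stage13HParams F 2) (hP : θ.Provisos₁₃CoPH F 2), ((θ.ZhUnity F 2 ∧ θ.SlotsNondegenerate₁₃ F 2) ∧ LiveSel F θ) → θ.Admissible F 2 →
      ∀ (g₀ : ℕ → ℝ) (os : List (ULoop F)),
        ∃ W : ℕ → ℝ, RelWeightBound 1 (classSet₁₃ θ 0 g₀)
          (gapWeight2A₁₃ θ hP 0 g₀ os (ρ F θ hP g₀ os) (ρ' F θ hP g₀ os) (n₁ F θ hP g₀ os) (n₂ F θ hP g₀ os))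
          (gapWeight2B₁₃ θ hP 0 g₀ os (ρ F θ hP g₀ os) (ρ' F θ hP g₀ os) (n₁ F θ hP g₀ os) (n₂ F θ hP g₀ os)) (badClass₁₃ θ 0 g₀ (jc F θ hP g₀ os)) W)
    (h19 : ∀ (F : T4Family) (θ : Stage13HParams F 2) (h : θ.Provisos₁₃SepCoPH F 2) (v : Revision₁₃ F 2 θ h),
      ((θ.ZhUnity F 2 ∧ θ.SlotsNondegenerate₁₃ F 2) ∧ LiveSel F θ) → θ.Admissible F 2 →
      B16.EndStatementBPrinted (datumOfRecord₁₃SepCoPHV F 2 θ h v).C → DagBinding.EndpointExistence (datumOfRecord₁₃SepCoPHV F 2 θ h v).C.toB12 →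
        ForSmallCouplings (datumOfRecord₁₃SepCoPHV F 2 θ h v) fun g₀ => ∀ os : List (ULoop F),
          PHolderD4 β (datumOfRecord₁₃SepCoPHV F 2 θ h v) (rr F θ h.toCore g₀ os) →
            letI : DecidableEq (Σ K, SiteSeqKey F (0 + K)) := Classical.decEq _
            ∃ δ : ℕ → ℝ, NE7.Core 1 (F.side ^ 4) (classSet₁₃ θ 0 g₀) (badClass₁₃ θ 0 g₀ (jc F θ h.toCore g₀ os))
              (gapCore2A₁₃ θ h.toCore 0 g₀ os (ρ F θ h.toCore g₀ os) (ρ' F θ h.toCore g₀ os) (n₁ F θ h.toCore g₀ os) (n₂ F θ h.toCore g₀ os))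
              (gapCore2B₁₃ θ h.toCore 0 g₀ os (ρ F θ h.toCore g₀ os) (ρ' F θ h.toCore g₀ os) (n₁ F θ h.toCore g₀ os) (n₂ F θ h.toCore g₀ os)) δ ∧ Summable δ)
    (htarget : ∀ (F : T4Family) (θ : Stage13HParams F 2) (hP : θ.Provisos₁₃CoPH F 2), ((θ.ZhUnity F 2 ∧ θ.SlotsNondegenerate₁₃ F 2) ∧ ¬ LiveSel F θ) → θ.Admissible F 2 →
      ∀ (g₀ : ℕ → ℝ) (os : List (ULoop F)), PHolderD4 β (datumOfRecord₁₃CoPH F 2 θ hP) (rr F θ hP g₀ os) →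
        ∃ δ : ℕ → ℝ, NE7.Target ((F.side : ℝ) ^ 4) 1 δ (fun K => T4GenFunBounds.schemeZ ((datumOfRecord₁₃CoPH F 2 θ hP).scheme g₀) os (0 + K))) :
    Summit.QuantumFields.YangMills.Theses.BalabanUVNodes.SpineGivenEndpointR13SepCoPHV := by
  obtain ⟨cr, hon, hoff⟩ := exists_reading_livePin (fun F θ hP g₀ os => crGap2₁₃V 2 (jc F θ hP g₀ os) ρ ρ' n₁ n₂ F θ hP g₀ os)
  exact spineGivenEndpointR13SepCoPHV_of_gap2Pin jc ρ ρ' n₁ n₂ hon hoff hζm β rr hρ hn hε hδ (keyedRelWeight_of_gap2Pin_of_witness jc ρ ρ' n₁ n₂ hon hoff h20) hr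
    (keyedCoreEdgeHolderD4V_of_gap2Pin_of_witness jc ρ ρ' n₁ n₂ hon hoff hζm β rr hρ hn hε hδ h19 htarget)

/-- ★★ **WHAT STUB 2 WOULD READ UNDER A PAIR PIN**: a spine reading pinned to `crGap2₁₃V 2 (jc …) ρ ρ′ n₁ n₂` on the live line ∕ `crOneTerm₁₃ 0` off it carrying ALL FOUR K5 faces,
N21's and N27x's by THEOREM. [bookkeeping] -/
theorem exists_gap2Pinned_faces (β : ℝ) (rr : RateReadingFn) (jc : CutReading) (ρ ρ' : WidthLetter₁₃CoPH 2) (n₁ n₂ : DepthLetter₁₃CoPH 2)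
    (hζm : ∀ (F : T4Family) (θ : Stage13HParams F 2), θ.Provisos₁₃CoPH F 2 → ((θ.ZhUnity F 2 ∧ θ.SlotsNondegenerate₁₃ F 2) ∧ LiveSel F θ) → θ.Admissible F 2 →
      ZetaMeasurable F 2 θ.ζ)
    (hρ : ∀ (F : T4Family) (θ : Stage13HParams F 2) (hP : θ.Provisos₁₃CoPH F 2) (g₀ : ℕ → ℝ) (os : List (ULoop F)) (K : ℕ),
      (0 ≤ ρ F θ hP g₀ os K ∧ ρ F θ hP g₀ os K ≤ 1) ∧ (0 ≤ ρ' F θ hP g₀ os K ∧ ρ' F θ hP g₀ os K ≤ 1))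
    (hn : ∀ (F : T4Family) (θ : Stage13HParams F 2) (hP : θ.Provisos₁₃CoPH F 2) (g₀ : ℕ → ℝ) (os : List (ULoop F)),
      Summable (fun K => 1 / ((n₁ F θ hP g₀ os K : ℝ) + 1) + 1 / ((n₂ F θ hP g₀ os K : ℝ) + 1)))
    (hε : ∀ (F : T4Family) (θ : Stage13HParams F 2) (hP : θ.Provisos₁₃CoPH F 2) (g₀ : ℕ → ℝ) (os : List (ULoop F)) (K : ℕ),
      (0 ≤ epsOfRecord θ.ν (histA₁₃ θ 0 g₀ K) (0 + K) ∧ 0 ≤ epsOfRecord θ.ν (histB₁₃ θ 0 g₀ K) (0 + K + 1)) ∨ ρ F θ hP g₀ os K = 0)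
    (hδ : ∀ (F : T4Family) (θ : Stage13HParams F 2) (hP : θ.Provisos₁₃CoPH F 2) (g₀ : ℕ → ℝ) (os : List (ULoop F)) (K : ℕ),
      (0 ≤ deltaOfRecord θ.ν (histA₁₃ θ 0 g₀ K) (0 + K - 1) θ.A₁ ∧ 0 ≤ deltaOfRecord θ.ν (histB₁₃ θ 0 g₀ K) (0 + K) θ.A₁) ∨ ρ' F θ hP g₀ os K = 0)
    (h20 : ∀ (F : T4Family) (θ : Stage13HParams F 2) (hP : θ.Provisos₁₃CoPH F 2), ((θ.ZhUnity F 2 ∧ θ.SlotsNondegenerate₁₃ F 2) ∧ LiveSel F θ) → θ.Admissible F 2 →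
      ∀ (g₀ : ℕ → ℝ) (os : List (ULoop F)),
        ∃ W : ℕ → ℝ, RelWeightBound 1 (classSet₁₃ θ 0 g₀)
          (gapWeight2A₁₃ θ hP 0 g₀ os (ρ F θ hP g₀ os) (ρ' F θ hP g₀ os) (n₁ F θ hP g₀ os) (n₂ F θ hP g₀ os))
          (gapWeight2B₁₃ θ hP 0 g₀ os (ρ F θ hP g₀ os) (ρ' F θ hP g₀ os) (n₁ F θ hP g₀ os) (n₂ F θ hP g₀ os)) (badClass₁₃ θ 0 g₀ (jc F θ hP g₀ os)) W)
    (h19 : ∀ (F : T4Family) (θ : Stage13HParams F 2) (h : θ.Provisos₁₃SepCoPH F 2) (v : Revision₁₃ F 2 θ h),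
      ((θ.ZhUnity F 2 ∧ θ.SlotsNondegenerate₁₃ F 2) ∧ LiveSel F θ) → θ.Admissible F 2 →
      B16.EndStatementBPrinted (datumOfRecord₁₃SepCoPHV F 2 θ h v).C → DagBinding.EndpointExistence (datumOfRecord₁₃SepCoPHV F 2 θ h v).C.toB12 →
        ForSmallCouplings (datumOfRecord₁₃SepCoPHV F 2 θ h v) fun g₀ => ∀ os : List (ULoop F),
          PHolderD4 β (datumOfRecord₁₃SepCoPHV F 2 θ h v) (rr F θ h.toCore g₀ os) →
            letI : DecidableEq (Σ K, SiteSeqKey F (0 + K)) := Classical.decEq _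
            ∃ δ : ℕ → ℝ, NE7.Core 1 (F.side ^ 4) (classSet₁₃ θ 0 g₀) (badClass₁₃ θ 0 g₀ (jc F θ h.toCore g₀ os))
              (gapCore2A₁₃ θ h.toCore 0 g₀ os (ρ F θ h.toCore g₀ os) (ρ' F θ h.toCore g₀ os) (n₁ F θ h.toCore g₀ os) (n₂ F θ h.toCore g₀ os))
              (gapCore2B₁₃ θ h.toCore 0 g₀ os (ρ F θ h.toCore g₀ os) (ρ' F θ h.toCore g₀ os) (n₁ F θ h.toCore g₀ os) (n₂ F θ h.toCore g₀ os)) δ ∧ Summable δ)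
    (htarget : ∀ (F : T4Family) (θ : Stage13HParams F 2) (hP : θ.Provisos₁₃CoPH F 2), ((θ.ZhUnity F 2 ∧ θ.SlotsNondegenerate₁₃ F 2) ∧ ¬ LiveSel F θ) → θ.Admissible F 2 →
      ∀ (g₀ : ℕ → ℝ) (os : List (ULoop F)), PHolderD4 β (datumOfRecord₁₃CoPH F 2 θ hP) (rr F θ hP g₀ os) →
        ∃ δ : ℕ → ℝ, NE7.Target ((F.side : ℝ) ^ 4) 1 δ (fun K => T4GenFunBounds.schemeZ ((datumOfRecord₁₃CoPH F 2 θ hP).scheme g₀) os (0 + K))) :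
    ∃ cr : SpineReading,
      (∀ (F : T4Family) (θ : Stage13HParams F 2) (hP : θ.Provisos₁₃CoPH F 2) (g₀ : ℕ → ℝ) (os : List (ULoop F)),
        LiveSel F θ → cr F θ hP g₀ os = crGap2₁₃V 2 (jc F θ hP g₀ os) ρ ρ' n₁ n₂ F θ hP g₀ os) ∧
      (∀ (F : T4Family) (θ : Stage13HParams F 2) (hP : θ.Provisos₁₃CoPH F 2) (g₀ : ℕ → ℝ) (os : List (ULoop F)),
        ¬ LiveSel F θ → cr F θ hP g₀ os = crOneTerm₁₃ 0 F θ hP g₀ os) ∧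
      KeyedRelWeight cr ∧ KeyedShellWeight cr ∧ KeyedExtractionV cr ∧ KeyedCoreEdgeHolderD4V β cr rr := by
  obtain ⟨cr, hon, hoff⟩ := exists_reading_livePin (fun F θ hP g₀ os => crGap2₁₃V 2 (jc F θ hP g₀ os) ρ ρ' n₁ n₂ F θ hP g₀ os)
  exact ⟨cr, hon, hoff, keyedRelWeight_of_gap2Pin_of_witness jc ρ ρ' n₁ n₂ hon hoff h20, keyedShellWeight_of_gap2Pin jc ρ ρ' n₁ n₂ hon hoff hζm hρ hn hε hδ,
    (keyedExtraction_of_gap2Pin jc ρ ρ' n₁ n₂ hon hoff hζm).2, keyedCoreEdgeHolderD4V_of_gap2Pin_of_witness jc ρ ρ' n₁ n₂ hon hoff hζm β rr hρ hn hε hδ h19 htarget⟩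

end Gap2Road

end Summit.QuantumFields.YangMills.Theorems.N21GappedRoadK3V6Knit

end
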